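import Mathlib
import HarnessLib
import Summits.NavierStokesRegularity.NavierStokesRegularity.Theorems.ThreadingFluxHorizonTowerDipoleTowerOrderOne
import Summits.NavierStokesRegularity.NavierStokesRegularity.Theorems.ThreadingFluxHorizonTowerTailRung
import Summits.NavierStokesRegularity.NavierStokesRegularity.Theorems.ThreadingFluxHorizonOrderOneLawBlowdown

/-!
# Crux `PoloidalLiouville` (stmt-NavierStokesRegularity-1222, wall W1), crux idea «horizon-threading-tower» (ns-idea-15):
# LEVER → DIPOLE TOWER — a three-shell scale-free horizon of an unthreaded classical window is axisymmetric without swirl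

ARM A (ns-exp-scalarLiouville g6), menu item N-2 = I-3 (director-ns 07:09:26Z «then N-2 (S) if time»; crit-1 g5: S · information).
Composition BY NAME of two tree theorems: the ORDER-ONE HORIZON LAW in blow-down form (`HorizonTower.orderOneHorizonLawBlowdown`,
ns-wall-eng-4, `Theorems/ThreadingFluxHorizonOrderOneLawBlowdown.lean`; sketch `HorizonTowerSketch.lean` v5 l.471–482) and «dipole towers
decided at order one» (`dipoleTowerHorizonZonality_of`, p700930).  Statement ★ `dipoleTower_zonalForm_of_blowdown`: if `(u, p)` is a
classical Navier–Stokes solution on an open time window `S ∋ t₀`, unthreaded about `x₀` at all times of `S`, and the slice at `t₀` has as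
a blow-down limit (in the sense `IsBlowdownLimit`, any pressure datum `P₀`) the THREE-SHELL DIPOLE TOWER `U_A + U_B + U_C` (`A ∈ 𝓗_1`,
`B ∈ 𝓗_m`, `C ∈ 𝓗_n` non-zero solid harmonics, `2 ≤ m ≠ n`, `m, n` not both odd), then that horizon is COAXIALLY ZONAL.  The smoothness
of the tower off the centre required by the blow-down law is supplied by `contDiffAt_horizonProfile` (TailRung), so no regularity
hypothesis on `U` appears.

HONEST LABEL: information-grade rung-shaped composition (the first kernel sentence «classical NS window, unthreaded ⇒ its three-shell
scale-free horizon is axisymmetric without swirl»); `HorizonTowerZonality`, `PoloidalLiouville` (1222), W1 and NS regularity are OPEN /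
NOT proved (W1 movement 0); scope as in V9-P2 (only slices possessing such a blow-down limit are bound).
`--supports stmt-NavierStokesRegularity-1222 --as helper`.
-/

-- the summit and its single sub-problem share the name (CONVENTIONS §1)
set_option linter.dupNamespace false

noncomputable section

namespace Summit.NavierStokesRegularity.NavierStokesRegularity.Theorems.PoloidalLiouville.HorizonTower

open Set Function Filter Topology
open scoped RealInnerProductSpace
open Literature.Analysis.FluidPDE

section DipoleTowerBlowdown

/-- The three-shell dipole tower is `C²` (indeed smooth) off the centre. [folklore] -/
theorem contDiffOn_dipoleTower {m n : ℕ} {A B C : E3 → ℝ} (hm : 2 ≤ m) (hn : 2 ≤ n)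
    (hA : ContDiff ℝ (⊤ : ℕ∞) A) (hhomA : ∀ (c : ℝ) (y : E3), A (c • y) = c ^ 1 * A y) (hharmA : ∀ y, Laplacian.laplacian A y = 0)
    (hB : ContDiff ℝ (⊤ : ℕ∞) B) (hhomB : ∀ (c : ℝ) (y : E3), B (c • y) = c ^ m * B y) (hharmB : ∀ y, Laplacian.laplacian B y = 0)
    (hC : ContDiff ℝ (⊤ : ℕ∞) C) (hhomC : ∀ (c : ℝ) (y : E3), C (c • y) = c ^ n * C y) (hharmC : ∀ y, Laplacian.laplacian C y = 0) :
    ContDiffOn ℝ 2 (fun z => horizonProfile 1 A 0 z + horizonProfile m B 0 z + horizonProfile n C 0 z) {0}ᶜ := by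
  intro z hz
  have hz' : z ≠ 0 := hz
  have h1 := contDiffAt_horizonProfile (l := 1) le_rfl hA hhomA hharmA hz'
  have h2 := contDiffAt_horizonProfile (l := m) (by omega) hB hhomB hharmB hz'
  have h3 := contDiffAt_horizonProfile (l := n) (by omega) hC hhomC hharmC hz'
  exact (((h1.add h2).add h3).of_le (by norm_cast)).contDiffWithinAt

/-- ★ **LEVER → DIPOLE TOWER.**  A classical Navier–Stokes solution on an open window `S ∋ t₀`, unthreaded about `x₀` on `S`, whose
slice at `t₀` blows down (`IsBlowdownLimit`, any pressure datum) to the three-shell dipole tower `U_A + U_B + U_C` (`A ∈ 𝓗_1`, `B ∈ 𝓗_m`,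
`C ∈ 𝓗_n` non-zero, `2 ≤ m ≠ n`, `m, n` not both odd): the horizon is coaxially zonal — `orderOneHorizonLawBlowdown` (eng-4) feeds
`𝔏₁ ≡ 0` into `dipoleTowerHorizonZonality_of` (p700930). [folklore] -/
theorem dipoleTower_zonalForm_of_blowdown (S : Set ℝ) (u : ℝ → E3 → E3) (p : ℝ → E3 → ℝ) (x₀ : E3) (t₀ : ℝ) (P₀ : E3 → ℝ)
    {m n : ℕ} {A B C : E3 → ℝ} (hS : IsOpen S) (ht₀ : t₀ ∈ S) (hNS : IsClassicalNSSolutionOn S 1 0 u p)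
    (hF : ∀ t ∈ S, ∀ x, threadingFlux u x₀ t x = 0)
    (hm : 2 ≤ m) (hn : 2 ≤ n) (hmn : m ≠ n) (hpar : Even m ∨ Even n)
    (hA : ContDiff ℝ (⊤ : ℕ∞) A) (hhomA : ∀ (c : ℝ) (y : E3), A (c • y) = c ^ 1 * A y) (hharmA : ∀ y, Laplacian.laplacian A y = 0)
    (hB : ContDiff ℝ (⊤ : ℕ∞) B) (hhomB : ∀ (c : ℝ) (y : E3), B (c • y) = c ^ m * B y) (hharmB : ∀ y, Laplacian.laplacian B y = 0)
    (hC : ContDiff ℝ (⊤ : ℕ∞) C) (hhomC : ∀ (c : ℝ) (y : E3), C (c • y) = c ^ n * C y) (hharmC : ∀ y, Laplacian.laplacian C y = 0)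
    (hA0 : ∃ y, A y ≠ 0) (hB0 : ∃ y, B y ≠ 0) (hC0 : ∃ y, C y ≠ 0)
    (hbd : IsBlowdownLimit (u t₀) (p t₀) x₀
      (fun z => horizonProfile 1 A 0 z + horizonProfile m B 0 z + horizonProfile n C 0 z) P₀) :
    ∃ (a : E3) (gA gB gC : ℝ → ℝ), a ≠ 0 ∧
      (∀ y : E3, y ≠ 0 → A y = ‖y‖ ^ 1 * gA (inner ℝ a y / ‖y‖)) ∧
      (∀ y : E3, y ≠ 0 → B y = ‖y‖ ^ m * gB (inner ℝ a y / ‖y‖)) ∧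
      (∀ y : E3, y ≠ 0 → C y = ‖y‖ ^ n * gC (inner ℝ a y / ‖y‖)) := by
  have hU := contDiffOn_dipoleTower hm hn hA hhomA hharmA hB hhomB hharmB hC hhomC hharmC
  have hL1 := orderOneHorizonLawBlowdown S u p x₀ t₀ _ P₀ hS ht₀ hNS hF hU hbd
  exact dipoleTowerHorizonZonality_of m n A B C hm hn hmn hpar hA hhomA hharmA hB hhomB hharmB hC hhomC hharmC hA0 hB0 hC0 hL1

end DipoleTowerBlowdown

end Summit.NavierStokesRegularity.NavierStokesRegularity.Theorems.PoloidalLiouville.HorizonTower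

end
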